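import Summits.QuantumFields.YangMills.Theorems.SoloBlindNoUniformRate
import HarnessLib

/-!
# Spacing pinning: a physical-time ratio floor ties the lattice correlation length to `1/a_k`
# (solo-QuantumFields-blind, rung D18)

`Summit.QuantumFields.YangMills.Theorems.SoloBlindSpacingPinning` (read-only conjunct `YangMills`).
Reading (R2′) of this unit's obstruction paper says that in ANY witness of `YangMills` the scheme's
spacing `a_k` is pinned to the lattice correlation length at `β_k`: the lattice-gap conjunct
`HasLatticeMassGap r sch Δ` bounds the lattice decay rate of every species from BELOW by `Δ a_k`,
while convergence of the renormalised curvature two-point function at two physical times to a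
limit that is non-zero at the later time (`IsYangMillsFor` + `IsNontrivial`) bounds it from ABOVE
by `κ a_k`, through reflection positivity alone.  This file kernel-checks the second half on the
statement's own odd tori `(ℤ/(2S+1))⁴`, for a species `A` on the time-zero spatial links, with
the analytic input typed as a hypothesis (`HasPhysicalRatioFloor`: at lattice times
`n₁ k < n₂ k` of physical separation `≥ τ` and bounded physical time, `ϑ·c_k(S; n₁ k) ≤ c_k(S; n₂ k)`
and `c_k(S; n₂ k) ≥ η_k > 0` on every torus `S ≥ L_k`, eventually in `k`):

* `mulConvex_ratio_floor`, `mulConvex_lower_envelope` — discrete: for a non-negative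
  multiplicatively convex sequence on `[0, K]`, a ratio floor `θ^{n₂-n₁} a n₁ ≤ a n₂` across ONE
  pair `n₁ < n₂` forces `θ · a q ≤ a (q+1)` for every later step and hence the geometric lower
  envelope `θ^{n-n₂} a n₂ ≤ a n` on `n₂ ≤ n ≤ K` (one up-step of `a k/θ^k` propagates, part 3);
* `ratioFloor_lower_envelope` — scheme level: with `κ := -log ϑ / τ`, eventually in `k`, on every
  torus `S ≥ L_k`, `η_k e^{-κ a_k (n - n₂ k)} ≤ c_k(S; n)` for `n₂ k ≤ n ≤ S`: beyond physical
  times the statement's correlator decays no faster than rate `κ a_k` per lattice step;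
* `eventually_not_clustersAtRate_of_ratioFloor` — hence for every fixed lattice rate `m₀ > 0`,
  eventually in `k` the pair `(A, A)` does NOT cluster torus-uniformly at rate `m₀` at `β_k`
  (IR-0 ALONG THE WITNESS SEQUENCE is necessary; compare rung D9, where the same conclusion in
  `β → ∞` form is derived from local Gaussianity);
* `gap_le_of_ratioFloor` / `latticeMassGap_le_of_ratioFloor` — and the sandwich with the
  antipodal form of the gap clause (part 6): `HasAntipodalDecay r sch Δ A` (in particular
  `HasLatticeMassGap r sch Δ`) forces `Δ ≤ κ`: the two lattice rates `Δ a_k ≤ κ a_k` are both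
  `≍ a_k`.

No analysis is done here; the smearing dictionary deriving `HasPhysicalRatioFloor` from
`IsYangMillsFor ∧ IsNontrivial` is prose (obstruction paper §1 (R2′)). [this unit's; mechanism
folklore: OS positivity ⇒ log-convexity ⇒ monotone one-step ratios]
-/

open MeasureTheory Filter Topology
open Literature.MathematicalPhysics.QuantumFieldTheory Literature.MathematicalPhysics.QuantumLattice

noncomputable section

namespace Summit.QuantumFields.YangMills.Theorems.SoloBlind

/-! ### Discrete lemmas: one ratio floor propagates -/

/-- **Ratio floor propagates.**  `a ≥ 0` multiplicatively convex on `[0, K]`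
(`a (k+1)² ≤ a k · a (k+2)`), `θ > 0`, `n₁ < n₂ ≤ K` and `θ^{n₂-n₁} · a n₁ ≤ a n₂`: then
`θ · a q ≤ a (q+1)` for every `n₂ ≤ q`, `q + 1 ≤ K` (some step of `k ↦ a k / θ^k` in `[n₁, n₂)`
goes up, and an up-step propagates, `mulConvex_upStep_propagates`). [this unit's; elementary] -/
theorem mulConvex_ratio_floor {a : ℕ → ℝ} {K : ℕ} (h0 : ∀ k, k ≤ K → 0 ≤ a k)
    (hconv : ∀ k, k + 2 ≤ K → a (k + 1) ^ 2 ≤ a k * a (k + 2)) {θ : ℝ} (hθ : 0 < θ)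
    {n₁ n₂ : ℕ} (h12 : n₁ < n₂) (hfloor : θ ^ (n₂ - n₁) * a n₁ ≤ a n₂) :
    ∀ q, n₂ ≤ q → q + 1 ≤ K → θ * a q ≤ a (q + 1) := by
  set b : ℕ → ℝ := fun k => a k / θ ^ k with hb
  have hb0 : ∀ k, k ≤ K → 0 ≤ b k := fun k hk => div_nonneg (h0 k hk) (pow_nonneg hθ.le k)
  have hbconv : ∀ k, k + 2 ≤ K → b (k + 1) ^ 2 ≤ b k * b (k + 2) := by
    intro k hk
    have hc := hconv k hk
    have hpow : (θ ^ (k + 1)) ^ 2 = θ ^ k * θ ^ (k + 2) := by ring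
    simp only [hb, div_pow, div_mul_div_comm, hpow]
    exact div_le_div_of_nonneg_right hc (by positivity)
  -- an up-step of `b` converts back to a ratio floor of `a`
  have hconvert : ∀ q, b q ≤ b (q + 1) → θ * a q ≤ a (q + 1) := by
    intro q hq
    have hq' : a q / θ ^ q * θ ^ (q + 1) ≤ a (q + 1) / θ ^ (q + 1) * θ ^ (q + 1) :=
      mul_le_mul_of_nonneg_right hq (pow_pos hθ _).le
    rw [div_mul_cancel₀ _ (pow_pos hθ (q + 1)).ne'] at hq'
    calc θ * a q = a q / θ ^ q * θ ^ (q + 1) := by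
          rw [pow_succ, div_mul_eq_mul_div, eq_div_iff (pow_pos hθ q).ne']; ring
      _ ≤ a (q + 1) := hq'
  -- some step of `b` in `[n₁, n₂)` goes up
  have hex : ∃ l, n₁ ≤ l ∧ l < n₂ ∧ b l ≤ b (l + 1) := by
    by_contra hne
    push Not at hne
    have hdec : ∀ m, n₁ < m → m ≤ n₂ → b m < b n₁ := by
      intro m hm hmn
      induction m with
      | zero => exact absurd hm (Nat.not_lt_zero _)
      | succ m ih =>
        by_cases hm' : n₁ < m
        · exact (hne m hm'.le (by omega)).trans (ih hm' (by omega))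
        · have hmeq : m = n₁ := by omega
          subst hmeq
          exact hne m le_rfl (by omega)
    have hlt : b n₂ < b n₁ := hdec n₂ h12 le_rfl
    have e2 : a n₂ = b n₂ * θ ^ n₂ := by
      simp only [hb]; rw [div_mul_cancel₀ _ (pow_pos hθ n₂).ne']
    have e1 : b n₁ * θ ^ n₂ = θ ^ (n₂ - n₁) * a n₁ := by
      have hsplit : θ ^ n₂ = θ ^ (n₂ - n₁) * θ ^ n₁ := by
        rw [← pow_add, Nat.sub_add_cancel h12.le]
      simp only [hb]; rw [hsplit, div_mul_eq_mul_div, div_eq_iff (pow_pos hθ n₁).ne']; ring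
    have : a n₂ < θ ^ (n₂ - n₁) * a n₁ := by
      calc a n₂ = b n₂ * θ ^ n₂ := e2
        _ < b n₁ * θ ^ n₂ := mul_lt_mul_of_pos_right hlt (pow_pos hθ n₂)
        _ = θ ^ (n₂ - n₁) * a n₁ := e1
    linarith
  obtain ⟨l, -, hl2, hbl⟩ := hex
  intro q hq hqK
  exact hconvert q (mulConvex_upStep_propagates hb0 hbconv hbl q (by omega) hqK)

/-- **Geometric lower envelope** from a one-step ratio floor: if `θ ≥ 0` and `θ · a q ≤ a (q+1)`
for `n₂ ≤ q`, `q + 1 ≤ K`, then `θ^{n-n₂} · a n₂ ≤ a n` for `n₂ ≤ n ≤ K`. [folklore] -/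
theorem mulConvex_lower_envelope {a : ℕ → ℝ} {K n₂ : ℕ} {θ : ℝ} (hθ : 0 ≤ θ)
    (hstep : ∀ q, n₂ ≤ q → q + 1 ≤ K → θ * a q ≤ a (q + 1)) :
    ∀ n, n₂ ≤ n → n ≤ K → θ ^ (n - n₂) * a n₂ ≤ a n := by
  intro n hn hnK
  induction n with
  | zero =>
    have h0 : n₂ = 0 := by omega
    subst h0; simp
  | succ n ih =>
    rcases Nat.eq_or_lt_of_le hn with h | h
    · subst h; simp
    · calc θ ^ (n + 1 - n₂) * a n₂ = θ * (θ ^ (n - n₂) * a n₂) := by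
            rw [show n + 1 - n₂ = (n - n₂) + 1 by omega, pow_succ]; ring
        _ ≤ θ * a n := mul_le_mul_of_nonneg_left (ih (by omega) (by omega)) hθ
        _ ≤ a (n + 1) := hstep n (by omega) (by omega)

/-- **Rate comparison**: if `η e^{-u S} ≤ C e^{-v S}` for all large `S` with `η > 0`, then
`v ≤ u`. [folklore] -/
theorem rate_le_of_eventually_exp_le {η C u v : ℝ} (hη : 0 < η)
    (h : ∀ᶠ S : ℕ in atTop, η * Real.exp (-(u * S)) ≤ C * Real.exp (-(v * S))) : v ≤ u := by
  by_contra hlt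
  push Not at hlt
  have h2 : ∀ᶠ S : ℕ in atTop, η * Real.exp ((v - u) * S) ≤ C := by
    filter_upwards [h] with S hS
    have hS' := mul_le_mul_of_nonneg_right hS (Real.exp_pos (v * S)).le
    calc η * Real.exp ((v - u) * S)
          = η * (Real.exp (-(u * S)) * Real.exp (v * S)) := by
            rw [← Real.exp_add]; congr 1; congr 1; ring
      _ = η * Real.exp (-(u * S)) * Real.exp (v * S) := by ring
      _ ≤ C * Real.exp (-(v * S)) * Real.exp (v * S) := hS'
      _ = C * (Real.exp (-(v * S)) * Real.exp (v * S)) := by ring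
      _ = C := by rw [← Real.exp_add, neg_add_cancel, Real.exp_zero, mul_one]
  have hlim : Tendsto (fun S : ℕ => η * Real.exp ((v - u) * S)) atTop atTop :=
    Tendsto.const_mul_atTop hη
      (Real.tendsto_exp_atTop.comp (tendsto_natCast_atTop_atTop.const_mul_atTop (sub_pos.mpr hlt)))
  obtain ⟨S, hS1, hS2⟩ := ((hlim.eventually (eventually_gt_atTop C)).and h2).exists
  exact absurd hS2 (not_le.mpr hS1)

/-! ### Scheme level -/

variable {G : Type} [Group G] [TopologicalSpace G] [IsTopologicalGroup G] [CompactSpace G]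
  [MeasurableSpace G] [BorelSpace G]

/-- **Physical-time ratio floor** for the species `A` along the scheme, with physical separation
`τ` and ratio `ϑ`: there are lattice times `n₁ k < n₂ k` with `a_k (n₂ k - n₁ k) ≥ τ` and
`a_k · n₂ k ≤ t₂` such that, eventually in `k`, on EVERY torus `S ≥ L_k` the statement's
correlator obeys `c_k(S; n₂ k) ≥ η_k > 0` and `ϑ · c_k(S; n₁ k) ≤ c_k(S; n₂ k)`.  (Intended source,
prose: pointwise physical scaling of the two-point function of `A` at two physical times
`t₁ < t₂` with a limit positive at `t₂` — convergence of the renormalised correlations,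
`IsYangMillsFor`, plus `IsNontrivial`; the floor `η_k` carries the field renormalisation and may
depend on `k`, not on `S`.) [this unit's] -/
def HasPhysicalRatioFloor (r : LatticeRep G) (sch : SpeciesScheme (YMSpecies G)) (A : YMSpecies G)
    (τ ϑ : ℝ) : Prop :=
  ∃ n₁ n₂ : ℕ → ℕ, ∃ t₂ : ℝ, (∀ k, n₁ k < n₂ k) ∧ (∀ k, τ ≤ sch.a k * ((n₂ k - n₁ k : ℕ) : ℝ)) ∧
    (∀ k, sch.a k * n₂ k ≤ t₂) ∧
    ∀ᶠ k in atTop, ∃ η : ℝ, 0 < η ∧ ∀ S : ℕ, sch.L k ≤ S →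
      η ≤ latticeConnectedCorr r.ρ (sch.β k) (2 * S + 1) A.F A.F (n₂ k) ∧
      ϑ * latticeConnectedCorr r.ρ (sch.β k) (2 * S + 1) A.F A.F (n₁ k) ≤
        latticeConnectedCorr r.ρ (sch.β k) (2 * S + 1) A.F A.F (n₂ k)

omit [TopologicalSpace G] [IsTopologicalGroup G] [CompactSpace G] [BorelSpace G] in
/-- A bounded physical time is eventually inside the torus: `a_k n₂ k ≤ t₂` and `a_k L_k → ∞`
give `n₂ k < L_k` eventually. [folklore] -/
theorem eventually_lt_L_of_bounded_time (sch : SpeciesScheme (YMSpecies G)) {n₂ : ℕ → ℕ} {t₂ : ℝ}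
    (h : ∀ k, sch.a k * n₂ k ≤ t₂) : ∀ᶠ k in atTop, n₂ k < sch.L k := by
  filter_upwards [sch.tendsto_L.eventually_gt_atTop t₂] with k hk
  have hlt : sch.a k * n₂ k < sch.a k * sch.L k := lt_of_le_of_lt (h k) hk
  exact_mod_cast lt_of_mul_lt_mul_left hlt (sch.a_pos k).le

/-- **Lower envelope beyond physical times.**  Let `A` be time-zero spatial, `β_k → ∞`,
`0 < τ`, `0 < ϑ ≤ 1`, and `HasPhysicalRatioFloor r sch A τ ϑ` with lattice times `n₁, n₂`.  Put
`κ := -log ϑ / τ ≥ 0`.  Then eventually in `k` there is `η > 0` with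
`η · e^{-κ a_k (n - n₂ k)} ≤ c_k(S; n)` for every torus `S ≥ L_k` and every `n₂ k ≤ n ≤ S`: per
lattice step the statement's correlator loses at most the factor `e^{-κ a_k}`. [this unit's] -/
theorem ratioFloor_lower_envelope (r : LatticeRep G) {sch : SpeciesScheme (YMSpecies G)}
    (hw : sch.HasWeakCouplingLimit) (A : YMSpecies G) (hA : IsTimeZeroSpatial A) {τ ϑ : ℝ}
    (hτ : 0 < τ) (hϑ : 0 < ϑ) (hϑ1 : ϑ ≤ 1) {n₁ n₂ : ℕ → ℕ} {t₂ : ℝ} (h12 : ∀ k, n₁ k < n₂ k)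
    (hsep : ∀ k, τ ≤ sch.a k * ((n₂ k - n₁ k : ℕ) : ℝ)) (ht₂ : ∀ k, sch.a k * n₂ k ≤ t₂)
    (hfl : ∀ᶠ k in atTop, ∃ η : ℝ, 0 < η ∧ ∀ S : ℕ, sch.L k ≤ S →
      η ≤ latticeConnectedCorr r.ρ (sch.β k) (2 * S + 1) A.F A.F (n₂ k) ∧
      ϑ * latticeConnectedCorr r.ρ (sch.β k) (2 * S + 1) A.F A.F (n₁ k) ≤
        latticeConnectedCorr r.ρ (sch.β k) (2 * S + 1) A.F A.F (n₂ k)) :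
    ∀ᶠ k in atTop, ∃ η : ℝ, 0 < η ∧ ∀ S : ℕ, sch.L k ≤ S → ∀ n : ℕ, n₂ k ≤ n → n ≤ S →
      η * Real.exp (-(-Real.log ϑ / τ * (sch.a k * ((n - n₂ k : ℕ) : ℝ)))) ≤
        latticeConnectedCorr r.ρ (sch.β k) (2 * S + 1) A.F A.F n := by
  have hρ := r.continuous
  set κ : ℝ := -Real.log ϑ / τ with hκ
  have hκ0 : 0 ≤ κ := div_nonneg (neg_nonneg.mpr (Real.log_nonpos hϑ.le hϑ1)) hτ.le
  have hβ0 : ∀ᶠ k in atTop, 0 ≤ sch.β k := hw.eventually_ge_atTop 0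
  filter_upwards [hfl, hβ0, eventually_one_le_L sch, eventually_lt_L_of_bounded_time sch ht₂]
    with k hk hβ hL1 hn₂L
  obtain ⟨η, hη, hS⟩ := hk
  refine ⟨η, hη, fun S hLS n hn hnS => ?_⟩
  obtain ⟨hηS, hratio⟩ := hS S hLS
  have hS1 : 1 ≤ S := hL1.trans hLS
  -- per-step floor `θ = e^{-κ a_k}`; `θ^{n₂-n₁} ≤ ϑ` because `a_k (n₂-n₁) ≥ τ`
  set θ : ℝ := Real.exp (-(κ * sch.a k)) with hθ
  have hθpos : 0 < θ := Real.exp_pos _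
  have hθpow : ∀ j : ℕ, θ ^ j = Real.exp (-(κ * (sch.a k * (j : ℝ)))) := fun j => by
    rw [hθ, ← Real.exp_nat_mul]; ring_nf
  have hθd : θ ^ (n₂ k - n₁ k) ≤ ϑ := by
    rw [hθpow]
    calc Real.exp (-(κ * (sch.a k * ((n₂ k - n₁ k : ℕ) : ℝ))))
          ≤ Real.exp (-(κ * τ)) := Real.exp_le_exp.mpr (by nlinarith [hsep k])
      _ = ϑ := by
          rw [hκ, div_mul_cancel₀ _ hτ.ne', neg_neg, Real.exp_log hϑ]
  set c : ℕ → ℝ := fun j => latticeConnectedCorr r.ρ (sch.β k) (2 * S + 1) A.F A.F j with hc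
  have hc0 : ∀ j, j ≤ 2 * S + 1 → 0 ≤ c j := fun j _ =>
    latticeConnectedCorr_self_nonneg r.ρ hρ hβ hS1 A hA j
  have hcconv : ∀ j, j + 2 ≤ 2 * S + 1 → c (j + 1) ^ 2 ≤ c j * c (j + 2) := fun j hj =>
    latticeConnectedCorr_self_logConvex r.ρ hρ hβ hS1 A hA j hj
  have h12k : n₁ k < n₂ k := h12 k
  have hfloor : θ ^ (n₂ k - n₁ k) * c (n₁ k) ≤ c (n₂ k) :=
    (mul_le_mul_of_nonneg_right hθd (hc0 _ (by omega))).trans hratio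
  have hsteps := mulConvex_ratio_floor hc0 hcconv hθpos (h12 k) hfloor
  have henv := mulConvex_lower_envelope hθpos.le hsteps n hn (by omega)
  calc η * Real.exp (-(κ * (sch.a k * ((n - n₂ k : ℕ) : ℝ))))
        = η * θ ^ (n - n₂ k) := by rw [hθpow]
    _ ≤ θ ^ (n - n₂ k) * c (n₂ k) := by
        rw [mul_comm]; exact mul_le_mul_of_nonneg_left hηS (pow_nonneg hθpos.le _)
    _ ≤ c n := henv

/-- **IR-0 along the witness sequence is necessary.**  Under the hypotheses of
`ratioFloor_lower_envelope`: for every lattice rate `m₀ > 0`, eventually in `k` the pair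
`(A, A)` does NOT cluster torus-uniformly at rate `m₀` at the coupling `β_k` — the lattice
correlation length of `A` at `β_k` is `≳ 1/(κ a_k) → ∞`. [this unit's] -/
theorem eventually_not_clustersAtRate_of_ratioFloor (r : LatticeRep G)
    {sch : SpeciesScheme (YMSpecies G)} (hw : sch.HasWeakCouplingLimit) (A : YMSpecies G)
    (hA : IsTimeZeroSpatial A) {τ ϑ : ℝ} (hτ : 0 < τ) (hϑ : 0 < ϑ) (hϑ1 : ϑ ≤ 1)
    (h : HasPhysicalRatioFloor r sch A τ ϑ) {m₀ : ℝ} (hm₀ : 0 < m₀) :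
    ∀ᶠ k in atTop, ¬ ClustersAtRate r (sch.β k) A A m₀ := by
  obtain ⟨n₁, n₂, t₂, h12, hsep, ht₂, hfl⟩ := h
  set κ : ℝ := -Real.log ϑ / τ with hκ
  have hκ0 : 0 ≤ κ := div_nonneg (neg_nonneg.mpr (Real.log_nonpos hϑ.le hϑ1)) hτ.le
  -- eventually `κ a_k < m₀`
  have hsmall : ∀ᶠ k in atTop, κ * sch.a k < m₀ := by
    have ht : Tendsto (fun k => κ * sch.a k) atTop (𝓝 (κ * 0)) := sch.tendsto_a.const_mul κ
    rw [mul_zero] at ht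
    exact ht.eventually (Iio_mem_nhds hm₀)
  filter_upwards [ratioFloor_lower_envelope r hw A hA hτ hϑ hϑ1 h12 hsep ht₂ hfl, hsmall,
    eventually_lt_L_of_bounded_time sch ht₂] with k hk hκa hn₂L
  obtain ⟨η, hη, hS⟩ := hk
  rintro ⟨C, S₀, hC⟩
  -- compare at the antipode `n = S` for all large `S`
  have hev : ∀ᶠ S : ℕ in atTop,
      η * Real.exp (κ * (sch.a k * n₂ k)) * Real.exp (-(κ * sch.a k * S)) ≤
        C * Real.exp (-(m₀ * S)) := by
    filter_upwards [eventually_ge_atTop (max S₀ (sch.L k))] with S hSm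
    have hS0 : S₀ ≤ S := (le_max_left _ _).trans hSm
    have hLS : sch.L k ≤ S := (le_max_right _ _).trans hSm
    have hn₂S : n₂ k ≤ S := (hn₂L.le).trans hLS
    have hlow := hS S hLS S hn₂S le_rfl
    have hup : latticeConnectedCorr r.ρ (sch.β k) (2 * S + 1) A.F A.F S ≤
        C * Real.exp (-(m₀ * S)) := (le_abs_self _).trans (hC S hS0 S le_rfl)
    have hcast : ((S - n₂ k : ℕ) : ℝ) = (S : ℝ) - n₂ k := by push_cast [Nat.cast_sub hn₂S]; ring
    calc η * Real.exp (κ * (sch.a k * n₂ k)) * Real.exp (-(κ * sch.a k * S))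
          = η * Real.exp (-(κ * (sch.a k * ((S - n₂ k : ℕ) : ℝ)))) := by
            rw [mul_assoc, ← Real.exp_add, hcast]; ring_nf
      _ ≤ _ := hlow
      _ ≤ _ := hup
  have hη' : 0 < η * Real.exp (κ * (sch.a k * n₂ k)) := mul_pos hη (Real.exp_pos _)
  have := rate_le_of_eventually_exp_le (u := κ * sch.a k) (v := m₀) hη' hev
  linarith

/-- **The gap is bounded by the physical decay constant.**  Under the hypotheses of
`ratioFloor_lower_envelope`, antipodal decay of `A` at rate `Δ` along the scheme (part 6:
`HasAntipodalDecay r sch Δ A`, implied by the `(A, A)` clause of `HasLatticeMassGap r sch Δ`)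
forces `Δ ≤ κ = -log ϑ / τ`: on each large torus `η_k e^{-κ a_k (S - n₂ k)} ≤ c_k(S; S) ≤
C e^{-Δ a_k S}`, so the two lattice rates satisfy `Δ a_k ≤ κ a_k`. [this unit's] -/
theorem gap_le_of_ratioFloor (r : LatticeRep G) {sch : SpeciesScheme (YMSpecies G)}
    (hw : sch.HasWeakCouplingLimit) (A : YMSpecies G) (hA : IsTimeZeroSpatial A) {τ ϑ : ℝ}
    (hτ : 0 < τ) (hϑ : 0 < ϑ) (hϑ1 : ϑ ≤ 1) (h : HasPhysicalRatioFloor r sch A τ ϑ) {Δ : ℝ}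
    (hgap : HasAntipodalDecay r sch Δ A) : Δ ≤ -Real.log ϑ / τ := by
  obtain ⟨n₁, n₂, t₂, h12, hsep, ht₂, hfl⟩ := h
  obtain ⟨C, hC⟩ := hgap
  set κ : ℝ := -Real.log ϑ / τ with hκ
  obtain ⟨k, hk, hCk, hn₂L⟩ :=
    ((ratioFloor_lower_envelope r hw A hA hτ hϑ hϑ1 h12 hsep ht₂ hfl).and
      (hC.and (eventually_lt_L_of_bounded_time sch ht₂))).exists
  obtain ⟨η, hη, hS⟩ := hk
  have hev : ∀ᶠ S : ℕ in atTop,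
      η * Real.exp (κ * (sch.a k * n₂ k)) * Real.exp (-(κ * sch.a k * S)) ≤
        C * Real.exp (-(Δ * sch.a k * S)) := by
    filter_upwards [eventually_ge_atTop (sch.L k)] with S hLS
    have hn₂S : n₂ k ≤ S := (hn₂L.le).trans hLS
    have hlow := hS S hLS S hn₂S le_rfl
    have hup := hCk S hLS
    have hcast : ((S - n₂ k : ℕ) : ℝ) = (S : ℝ) - n₂ k := by push_cast [Nat.cast_sub hn₂S]; ring
    calc η * Real.exp (κ * (sch.a k * n₂ k)) * Real.exp (-(κ * sch.a k * S))
          = η * Real.exp (-(κ * (sch.a k * ((S - n₂ k : ℕ) : ℝ)))) := by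
            rw [mul_assoc, ← Real.exp_add, hcast]; ring_nf
      _ ≤ _ := hlow
      _ ≤ C * Real.exp (-(Δ * (sch.a k * S))) := hup
      _ = C * Real.exp (-(Δ * sch.a k * S)) := by ring_nf
  have hη' : 0 < η * Real.exp (κ * (sch.a k * n₂ k)) := mul_pos hη (Real.exp_pos _)
  have hle := rate_le_of_eventually_exp_le (u := κ * sch.a k) (v := Δ * sch.a k) hη' hev
  exact le_of_mul_le_mul_right hle (sch.a_pos k)

/-- **Spacing pinning, statement form.**  If `HasLatticeMassGap r sch Δ` holds and some time-zero
spatial species has a physical-time ratio floor `(τ, ϑ)` along the scheme (`β_k → ∞`), then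
`Δ ≤ -log ϑ / τ`; together with `eventually_not_clustersAtRate_of_ratioFloor` this is the
two-sided pinning `Δ a_k ≤ (lattice decay rate of A at β_k) ≤ (-log ϑ / τ) a_k` of reading (R2′).
[this unit's] -/
theorem latticeMassGap_le_of_ratioFloor (r : LatticeRep G) {sch : SpeciesScheme (YMSpecies G)}
    (hw : sch.HasWeakCouplingLimit) {Δ : ℝ} (hgap : HasLatticeMassGap r sch Δ) (A : YMSpecies G)
    (hA : IsTimeZeroSpatial A) {τ ϑ : ℝ} (hτ : 0 < τ) (hϑ : 0 < ϑ) (hϑ1 : ϑ ≤ 1)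
    (h : HasPhysicalRatioFloor r sch A τ ϑ) : Δ ≤ -Real.log ϑ / τ :=
  gap_le_of_ratioFloor r hw A hA hτ hϑ hϑ1 h (hasAntipodalDecay_of_hasLatticeMassGap hgap A)

end Summit.QuantumFields.YangMills.Theorems.SoloBlind

end
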